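import Mathlib
import Literature.NumberTheory.LFunctions.Zhang2022.KnifeEdgeBandScaleTail
import Literature.NumberTheory.LFunctions.Zhang2022.RepairRplus

/-!
# Zhang (2022), rung F-S3 (Landau–Siegel programme), sub-cell E: flatness of the discrete mean FROM THE BAND EDGE
# (`N₁ ≥ D·P·𝓛^{1058+2A}`, saving `𝓛^{−A}`) — the sampled-zero and discrete-mean corollaries of `tailInvisible_bandScale`

Y. Zhang, *Discrete mean estimates and the Landau–Siegel zero*, arXiv:2211.02515v1 [Zhang2022LandauSiegel] —
an unrefereed manuscript under adjudication. **WHAT THIS IS NOT: not a claim about Theorems 1–2 of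
arXiv:2211.02515, about Landau–Siegel zeros, or about Parity. The programme SEARCHES and TYPES.** The (A)-world
hypothesis «every sampled zero has `Re ρ = ½`» (Prop. 2.2 (i)) is DISPLAYED (kind (b)); nothing else of the manuscript
is used.

* `tailInvisible_bandScale_sampled` — at every sampled pair `(ψ, ρ) ∈ idx χ` (under the displayed `Re ρ = ½`), every
  block `[N₁, N₂)` of the profile polynomial of a 1-Lipschitz `‖g‖ ≤ 1` profile with
  `⌈D·P·𝓛^{1056+2A}⌉ + 1 ≤ N₁ ≤ N₂ ≤ ⌈P^{1+δ}⌉` is `≤ C·𝓛^{−A}` (p469201 `tailInvisible_bandScale` at `s = ρ`).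
* `discMeanFlat_bandEdge` — for all large `D`, under (b), for every such `g` and every
  `⌈D·P·𝓛^{1058+2A}⌉ + 1 ≤ N₁ ≤ N₂ ≤ ⌈P^{1+δ}⌉`:
  `|discMean(N₂) − discMean(N₁)| ≤ 𝓛^{−A}·(discMeanAbs(N₁) + discWeight)` (`Repair.discMean/discMeanAbs/discWeight`,
  p455670; via `abs_sum_mul_norm_sq_perturb_le` with `τ = C𝓛^{−A−1}`, `η = 𝓛^{−A}`, once `2C² ≤ 𝓛`). With the units
  lemma `discWeight ≤ 3𝓛⁹𝔓` (p467613) the right side is `𝓛^{−A}·discMeanAbs(N₁) + 3𝓛^{9−A}𝔓 = o(𝔞𝔓)` for `A ≥ 10`: no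
  main-order length gain from the TRUE band edge `z = 1 + α̃ + O(log𝓛/𝓛⁹)` on, for the whole smooth class — the
  fixed-`ε` threshold `P^{1+ε}` of `KnifeEdgeSmoothClass.discMeanFlat_lengths` (p456962) is not needed.

References: Zhang, arXiv:2211.02515v1, §2 (2.14)–(2.20), (2.30); §8 Lemma 8.1 [cite: Zhang2022LandauSiegel, §§2, 8];
Montgomery–Vaughan, Thm 9.18 [cite: MontgomeryVaughan2007, Thm 9.18].
-/

noncomputable section

open Complex Real Finset
open scoped NNReal

namespace Literature.NumberTheory.LFunctions.Zhang2022.KnifeEdgeInvisibleTail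

open Skeleton

/-- `L ≤ log D` once `⌈e^L⌉ ≤ D`. [folklore] -/
private theorem le_ell_of_ceil_exp_le₃ {L₀ : ℝ} {D : ℕ} (hD : ⌈Real.exp L₀⌉₊ ≤ D) : L₀ ≤ ell D := by
  have h : Real.exp L₀ ≤ (D : ℝ) := (Nat.le_ceil _).trans (by exact_mod_cast hD)
  exact (Real.le_log_iff_exp_le (lt_of_lt_of_le (Real.exp_pos _) h)).mpr h

/-- A sampled zero `ρ ∈ 𝔷(ψ)` has `|Im ρ| ≤ 8t₀` (`|Im ρ − 2πt₀| < 𝓛₁ = 𝓛⁴⁰⁵ ≤ t₀ = 𝓛⁵¹⁹`).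
[cite: Zhang2022LandauSiegel, §2 (2.8), (2.14)] -/
private theorem abs_im_le_of_mem_zeroSet₃ {D : ℕ} (x : Chr D) (hℓ1 : 1 ≤ ell D) {ρ : ℂ}
    (hρ : ρ ∈ zeroSet D x) : |ρ.im| ≤ 8 * t0 D := by
  have h1 : |ρ.im - 2 * Real.pi * t0 D| < ell1 D := hρ.2.1
  have h2 : ell1 D ≤ t0 D := by
    simp only [ell1, t0]; exact pow_le_pow_right₀ hℓ1 (by norm_num)
  have h3 : 0 ≤ t0 D := by simp only [t0]; positivity
  have hπ : Real.pi < 3.15 := Real.pi_lt_d2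
  have hπt : Real.pi * t0 D ≤ 3.15 * t0 D := mul_le_mul_of_nonneg_right hπ.le h3
  have hπt0 : 0 ≤ Real.pi * t0 D := mul_nonneg Real.pi_pos.le h3
  have h4 := abs_lt.mp h1
  rw [abs_le]; constructor <;> linarith

/-- **The band-scale tail at every sampled zero** (`0 < δ`, `A : ℕ`): there is `C > 0` such that for all large `D`,
every primitive quadratic `χ (mod D)`, IF every sampled zero has `Re ρ = ½`, then for every 1-Lipschitz profile `g`
with `‖g‖ ≤ 1`, every `⌈D·P·𝓛^{1056+2A}⌉ + 1 ≤ N₁ ≤ N₂ ≤ ⌈P^{1+δ}⌉` and every `(ψ, ρ) ∈ idx χ`,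
`‖Σ_{N₁ ≤ n < N₂} χψ(n) g(log n/log P) n^{−ρ}‖ ≤ C·𝓛^{−A}`. [cite: Zhang2022LandauSiegel, §2 (2.14), (2.30)]
[cite: MontgomeryVaughan2007, Thm 9.18] -/
theorem tailInvisible_bandScale_sampled {δ : ℝ} (hδ : 0 < δ) (A : ℕ) :
    ∃ C : ℝ, 0 < C ∧ Skeleton.ForAllLarge fun D _ χ =>
      (∀ i ∈ Skeleton.idx χ, (i.2).re = 1 / 2) →
        ∀ g : ℝ → ℂ, LipschitzWith 1 g → (∀ z, ‖g z‖ ≤ 1) →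
          ∀ N₁ N₂ : ℕ, ⌈(D : ℝ) * Skeleton.bigP D * Skeleton.ell D ^ (1056 + 2 * A)⌉₊ + 1 ≤ N₁ → N₁ ≤ N₂ →
            N₂ ≤ ⌈Skeleton.bigP D ^ (1 + δ)⌉₊ →
            ∀ i ∈ Skeleton.idx χ,
              ‖∑ n ∈ Finset.Ico N₁ N₂, Skeleton.pc χ i.1 n * g (Real.log n / Real.log (Skeleton.bigP D)) *
                  (n : ℂ) ^ (-i.2)‖ ≤ C * (Skeleton.ell D ^ A)⁻¹ := by
  obtain ⟨C, hC, D₁, hT⟩ := tailInvisible_bandScale hδ A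
  refine ⟨C, hC, max D₁ 3, ?_⟩
  intro D _ χ hD hquad hprim hcrit g hg hg1 N₁ N₂ hN₁ hN₁₂ hN₂ i hi
  have hD₁ : D₁ ≤ D := le_trans (le_max_left _ _) hD
  have hD3 : 3 ≤ D := le_trans (le_max_right _ _) hD
  have hT' := hT D χ hD₁ hquad hprim
  have hℓ1 : 1 ≤ ell D := (one_lt_ell hD3).le
  have hP : 0 < bigP D := Real.exp_pos _
  have hlogPpos : 0 < Real.log (bigP D) := by
    rw [bigP, Real.log_exp]; exact pow_pos (by linarith) 9
  -- the sampled zero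
  have hi' : i.1 ∈ finsetOf (PsiOne χ) ∧ i.2 ∈ finsetOf (zeroSet D i.1) := by
    simpa only [idx, Finset.mem_sigma] using hi
  have hz : i.2 ∈ zeroSet D i.1 := mem_of_mem_finsetOf hi'.2
  have hre : i.2.re = 1 / 2 := hcrit i hi
  have him : |i.2.im| ≤ 8 * t0 D := abs_im_le_of_mem_zeroSet₃ i.1 hℓ1 hz
  have h1σ : 1 / 2 - 1 / Real.log (bigP D) ≤ i.2.re := by
    rw [hre]; have := one_div_pos.mpr hlogPpos; linarith
  have h2σ : i.2.re ≤ 2 := by rw [hre]; norm_num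
  -- the block `[N₁, N₂) = (N₁ − 1, N₂ − 1]`
  have hN₁1 : 1 ≤ N₁ := le_trans (Nat.le_add_left 1 _) hN₁
  have hN₂1 : 1 ≤ N₂ := le_trans hN₁1 hN₁₂
  have hXs : N₁ - 1 + 1 = N₁ := Nat.sub_add_cancel hN₁1
  have hYs : N₂ - 1 + 1 = N₂ := Nat.sub_add_cancel hN₂1
  have hXY : N₁ - 1 ≤ N₂ - 1 := Nat.sub_le_sub_right hN₁₂ 1
  have hXr : (D : ℝ) * bigP D * ell D ^ (1056 + 2 * A) ≤ ((N₁ - 1 : ℕ) : ℝ) := by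
    have h1 : ⌈(D : ℝ) * bigP D * ell D ^ (1056 + 2 * A)⌉₊ ≤ N₁ - 1 := by omega
    exact (Nat.le_ceil _).trans (by exact_mod_cast h1)
  have hYr : (((N₂ - 1 : ℕ)) : ℝ) ≤ bigP D ^ (1 + δ) := by
    have hNδ1 : 1 ≤ ⌈bigP D ^ (1 + δ)⌉₊ := Nat.one_le_ceil_iff.mpr (Real.rpow_pos_of_pos hP _)
    have h1 : (((N₂ - 1 : ℕ)) : ℝ) ≤ ((⌈bigP D ^ (1 + δ)⌉₊ - 1 : ℕ) : ℝ) := by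
      exact_mod_cast Nat.sub_le_sub_right hN₂ 1
    refine h1.trans ?_
    rw [Nat.cast_sub hNδ1, Nat.cast_one]
    have := Nat.ceil_lt_add_one (Real.rpow_nonneg hP.le (1 + δ))
    linarith
  have key := hT' i.1 g hg hg1 i.2 h1σ h2σ him (N₁ - 1) (N₂ - 1) hXr hXY hYr
  rw [← hXs, ← hYs, Finset.Ico_add_one_add_one_eq_Ioc]
  exact key

/-- **Flatness of the discrete mean from the band edge** (`0 < δ`, `A : ℕ`; `Repair.discMean/discMeanAbs/discWeight`):
for all large `D` and every primitive quadratic `χ (mod D)`, IF every sampled zero has `Re ρ = ½`, then for every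
1-Lipschitz profile `g` with `‖g‖ ≤ 1` and every `⌈D·P·𝓛^{1058+2A}⌉ + 1 ≤ N₁ ≤ N₂ ≤ ⌈P^{1+δ}⌉`,
`|discMean(N₂) − discMean(N₁)| ≤ 𝓛^{−A}·(discMeanAbs(N₁) + discWeight)`. With `discWeight ≤ 3𝓛⁹𝔓`
(`Skeleton.discWeight_trivialScale_window`) this is `o(𝔞𝔓)` for `A ≥ 10`: no main-order length gain from the true
band edge on. [cite: Zhang2022LandauSiegel, §2 (2.16)–(2.20), (2.30); §8 Lemma 8.1] -/
theorem discMeanFlat_bandEdge (c' : ℝ) {δ : ℝ} (hδ : 0 < δ) (A : ℕ) :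
    Skeleton.ForAllLarge fun D _ χ =>
      (∀ i ∈ Skeleton.idx χ, (i.2).re = 1 / 2) →
        ∀ g : ℝ → ℂ, LipschitzWith 1 g → (∀ z, ‖g z‖ ≤ 1) →
          ∀ N₁ N₂ : ℕ, ⌈(D : ℝ) * Skeleton.bigP D * Skeleton.ell D ^ (1058 + 2 * A)⌉₊ + 1 ≤ N₁ → N₁ ≤ N₂ →
            N₂ ≤ ⌈Skeleton.bigP D ^ (1 + δ)⌉₊ →
            |Repair.discMean c' χ g N₂ - Repair.discMean c' χ g N₁| ≤
              (Skeleton.ell D ^ A)⁻¹ * (Repair.discMeanAbs c' χ g N₁ + Repair.discWeight c' χ) := by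
  obtain ⟨C, hC, D₁, hT⟩ := tailInvisible_bandScale_sampled hδ (A + 1)
  refine ⟨max D₁ (max 3 ⌈Real.exp (2 * C ^ 2)⌉₊), ?_⟩
  intro D _ χ hD hquad hprim hcrit g hg hg1 N₁ N₂ hN₁ hN₁₂ hN₂
  have hD₁ : D₁ ≤ D := le_trans (le_max_left _ _) hD
  have hD3 : 3 ≤ D := le_trans (le_trans (le_max_left _ _) (le_max_right _ _)) hD
  have hℓC : 2 * C ^ 2 ≤ ell D :=
    le_ell_of_ceil_exp_le₃ (le_trans (le_trans (le_max_right _ _) (le_max_right _ _)) hD)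
  have hℓ1 : 1 ≤ ell D := (one_lt_ell hD3).le
  have hℓ0 : 0 < ell D := by linarith
  have h1058 : 1058 + 2 * A = 1056 + 2 * (A + 1) := by ring
  rw [h1058] at hN₁
  have hT' := hT D χ hD₁ hquad hprim hcrit g hg hg1 N₁ N₂ hN₁ hN₁₂ hN₂
  have hN₁1 : 1 ≤ N₁ := le_trans (Nat.le_add_left 1 _) hN₁
  -- `τ = C·𝓛^{−(A+1)}`, `η = 𝓛^{−A}`
  set τ : ℝ := C * (ell D ^ (A + 1))⁻¹ with hτdef
  set η : ℝ := (ell D ^ A)⁻¹ with hηdef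
  have hη : 0 < η := inv_pos.mpr (pow_pos hℓ0 A)
  set t : ((_ : Chr D) × ℂ) → ℂ := fun i =>
    ∑ n ∈ Finset.Ico N₁ N₂, Skeleton.pc χ i.1 n * g (Real.log n / Real.log (Skeleton.bigP D)) *
      (n : ℂ) ^ (-i.2) with htdef
  have hτ : ∀ i ∈ Skeleton.idx χ, ‖t i‖ ≤ τ := fun i hi => hT' i hi
  have hsplit : ∀ i : ((_ : Chr D) × ℂ),
      Repair.profPoly χ i.1 g N₂ i.2 = Repair.profPoly χ i.1 g N₁ i.2 + t i := by
    intro i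
    simp only [Repair.profPoly, htdef]
    rw [← Finset.sum_Ico_consecutive _ hN₁1 hN₁₂]
  have key := abs_sum_mul_norm_sq_perturb_le (Skeleton.idx χ)
    (fun i : ((_ : Chr D) × ℂ) => (cstar c' D i.1 i.2).re * (omegaW D i.2).re)
    (fun i : ((_ : Chr D) × ℂ) => Repair.profPoly χ i.1 g N₁ i.2) t hη hτ
  have hdiff : Repair.discMean c' χ g N₂ - Repair.discMean c' χ g N₁ =
      ∑ i ∈ Skeleton.idx χ, (cstar c' D i.1 i.2).re * (omegaW D i.2).re *
        (‖Repair.profPoly χ i.1 g N₁ i.2 + t i‖ ^ 2 - ‖Repair.profPoly χ i.1 g N₁ i.2‖ ^ 2) := by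
    simp only [Repair.discMean]
    rw [← Finset.sum_sub_distrib]
    refine Finset.sum_congr rfl fun i _ => ?_
    rw [hsplit i]; ring
  have hAbs : Repair.discMeanAbs c' χ g N₁ =
      ∑ i ∈ Skeleton.idx χ, |(cstar c' D i.1 i.2).re * (omegaW D i.2).re| *
        ‖Repair.profPoly χ i.1 g N₁ i.2‖ ^ 2 := rfl
  have hWt : Repair.discWeight c' χ = ∑ i ∈ Skeleton.idx χ, |(cstar c' D i.1 i.2).re * (omegaW D i.2).re| := rfl
  rw [hdiff, hAbs, hWt]
  refine key.trans ?_
  -- coefficients: `τ²/η + τ² ≤ η` once `2C² ≤ 𝓛`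
  have hW0 : 0 ≤ ∑ i ∈ Skeleton.idx χ, |(cstar c' D i.1 i.2).re * (omegaW D i.2).re| :=
    Finset.sum_nonneg fun _ _ => abs_nonneg _
  have hcoef : τ ^ 2 / η + τ ^ 2 ≤ η := by
    have hA0 : 0 < ell D ^ A := pow_pos hℓ0 A
    have hA1 : 0 < ell D ^ (A + 1) := pow_pos hℓ0 (A + 1)
    have e1 : τ ^ 2 / η = C ^ 2 / (ell D ^ A * ell D ^ 2) := by
      rw [hτdef, hηdef]; field_simp; ring
    have e2 : τ ^ 2 = C ^ 2 / (ell D ^ (A + 1)) ^ 2 := by rw [hτdef]; field_simp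
    have hle2 : τ ^ 2 ≤ C ^ 2 / (ell D ^ A * ell D ^ 2) := by
      rw [e2]
      refine div_le_div_of_nonneg_left (sq_nonneg C) (by positivity) ?_
      have : (ell D ^ (A + 1)) ^ 2 = ell D ^ A * ell D ^ 2 * ell D ^ A := by ring
      rw [this]
      exact le_mul_of_one_le_right (by positivity) (one_le_pow₀ hℓ1)
    have hsum : τ ^ 2 / η + τ ^ 2 ≤ 2 * (C ^ 2 / (ell D ^ A * ell D ^ 2)) := by rw [e1]; linarith
    refine hsum.trans ?_
    have hre : 2 * (C ^ 2 / (ell D ^ A * ell D ^ 2)) = (2 * C ^ 2 / ell D ^ 2) * (ell D ^ A)⁻¹ := by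
      field_simp
    rw [hre, hηdef]
    refine mul_le_of_le_one_left (by positivity) ?_
    rw [div_le_one (by positivity)]
    nlinarith
  have hfin := mul_le_mul_of_nonneg_right hcoef hW0
  have hA0 : 0 ≤ ∑ i ∈ Skeleton.idx χ, |(cstar c' D i.1 i.2).re * (omegaW D i.2).re| *
      ‖Repair.profPoly χ i.1 g N₁ i.2‖ ^ 2 :=
    Finset.sum_nonneg fun _ _ => mul_nonneg (abs_nonneg _) (sq_nonneg _)
  rw [mul_add]
  linarith

end Literature.NumberTheory.LFunctions.Zhang2022.KnifeEdgeInvisibleTail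

end
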